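import Literature.Topology.FourManifolds.TrisectionsAssemblyHandles
import Literature.Topology.FourManifolds.TrisectionsSectorOneHandles
import Literature.Topology.FourManifolds.TrisectionsSectorThreeHandles
import HarnessLib

/-!
# Instantiating the trisection construction: the numerical side conditions (Gay–Kirby 2016, Lemma 14)

Topic `Literature/Topology/FourManifolds`; for the fact seat
`provefact-Literature.Topology.FourManifolds.exists_isBalancedGKTrisection` (Gay–Kirby 2016,
Thm. 4 via Lemma 14).  Everything in this file is **proved**; no named facts are introduced.

The construction of the sectors (`BiCollar.TriData`) has two numerical side conditions,
`hc2 : a + δ_U + 2ε ≤ c` (the band of the unit field and the rounding width fit below the top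
level) and `hη : 2ε ≤ η` (the rounding width is below the margin `η` of the link condition
`hL`).  Both are met by **shrinking the band** of the unit field across `∂X₁⁰`
(`LevelUnitField.shrink`, `BiCollar.shrink`: same field, narrower band of unit speed) and
choosing `ε` small (`TriData.ofLevels`, which also picks a bevel of small slope,
`BiCollar.exists_bevelData_small`, so that the handle decompositions of the straightened first
and third sectors are available: `TrisectionsSectorOneHandles.lean`,
`TrisectionsSectorThreeHandles.lean`).  Consequently
(`isBalancedGKTrisection_ofLevels`, `exists_isBalancedGKTrisection_of_handles`): **given**
bi-collar data `B₀` on the closed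
`4`-manifold `X` (a function `f` with regular level `a` and a unit field across it, a function
`g` on the level with regular level `b` and a unit field across it, `F = {g = b} ≠ ∅`) whose `f`
is Morse with gradient-like field, a regular level `c > a` of `f`, a margin `η > 0` with the
**link condition** (every point of the level flowing into a critical point `q` of `f` with
`a < f q ≤ c` has `g < b - η`: the attaching link of the `2`-handles lies inside
`H₁₂ = {g ≤ b}`, Gay–Kirby's first hypothesis of Lemma 14), the Morse data `handleCount 1 k`
of `f` below `a` (the `0`- and `1`-handles) and above `c` (the `3`- and `4`-handles, turned
about), a gap above `c` free of critical values with the Heegaard function's range small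
against it, and the remaining **four handle decompositions** of `isGKTrisection_of_handles`
(with `k₂ = k ≤ gen`), the manifold
`X` has a balanced `(gen, k)`-trisection in the sense of the corrected predicate
`Literature.Topology.FourManifolds.IsBalancedGKTrisection` — the shape of the named fact
`Literature.Topology.FourManifolds.exists_isBalancedGKTrisection` for this `X`.

## References

* D. Gay, R. Kirby, *Trisecting 4-manifolds*, Geom. Topol. 20 (2016) 3097–3132
  (arXiv:1205.1565): Def. 1; §4, Lemma 14 and its proof; Thm. 4. [GayKirby2016]
-/

open scoped Manifold ContDiff Topology
open Set Function Filter

noncomputable section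

universe u

namespace Literature.Topology.FourManifolds

/-! ### Shrinking the band of a unit field -/

namespace LevelUnitField

variable {n : ℕ} {M : Type u} [TopologicalSpace M] [ChartedSpace (EuclideanSpace ℝ (Fin (n + 1))) M]
  [IsManifold (𝓡 (n + 1)) ∞ M] {f : M → ℝ} {a : ℝ} (U : LevelUnitField n f a)

/-- **Shrinking the band**: the same field, with unit speed recorded on the narrower band
`f⁻¹[a - δ', a + δ']`, `0 < δ' ≤ δ`. [folklore] -/
def shrink (δ' : ℝ) (h0 : 0 < δ') (hle : δ' ≤ U.δ) : LevelUnitField n f a where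
  ξ := U.ξ
  contMDiff := U.contMDiff
  contMDiff_f := U.contMDiff_f
  δ := δ'
  δ_pos := h0
  mlineDeriv_eq_one x hx := U.mlineDeriv_eq_one x ⟨by linarith [hx.1], by linarith [hx.2]⟩

/-- The field is unchanged. [folklore] -/
@[simp] theorem shrink_ξ (δ' : ℝ) (h0 : 0 < δ') (hle : δ' ≤ U.δ) : (U.shrink δ' h0 hle).ξ = U.ξ := rfl

/-- The new half-width. [folklore] -/
@[simp] theorem shrink_δ (δ' : ℝ) (h0 : 0 < δ') (hle : δ' ≤ U.δ) : (U.shrink δ' h0 hle).δ = δ' := rfl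

end LevelUnitField

variable {X : Type u} [TopologicalSpace X] [ChartedSpace (EuclideanSpace ℝ (Fin 4)) X] [IsManifold (𝓡 4) ∞ X]

namespace BiCollar

variable (B : BiCollar X)

/-- **Shrinking the band of a bi-collar**: the same data with the band of `U` narrowed to
half-width `δ'`. [folklore] -/
def shrink (δ' : ℝ) (h0 : 0 < δ') (hle : δ' ≤ B.U.δ) : BiCollar X :=
  { B with U := B.U.shrink δ' h0 hle }

/-- The function `f` is unchanged. [folklore] -/
@[simp] theorem shrink_f (δ' : ℝ) (h0 : 0 < δ') (hle : δ' ≤ B.U.δ) : (B.shrink δ' h0 hle).f = B.f := rfl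
/-- The level `a` is unchanged. [folklore] -/
@[simp] theorem shrink_a (δ' : ℝ) (h0 : 0 < δ') (hle : δ' ≤ B.U.δ) : (B.shrink δ' h0 hle).a = B.a := rfl
/-- The field is unchanged. [folklore] -/
@[simp] theorem shrink_U_ξ (δ' : ℝ) (h0 : 0 < δ') (hle : δ' ≤ B.U.δ) : (B.shrink δ' h0 hle).U.ξ = B.U.ξ := rfl
/-- The new half-width. [folklore] -/
@[simp] theorem shrink_U_δ (δ' : ℝ) (h0 : 0 < δ') (hle : δ' ≤ B.U.δ) : (B.shrink δ' h0 hle).U.δ = δ' := rfl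
/-- The Heegaard function is unchanged. [folklore] -/
@[simp] theorem shrink_g (δ' : ℝ) (h0 : 0 < δ') (hle : δ' ≤ B.U.δ) : (B.shrink δ' h0 hle).g = B.g := rfl
/-- The level `b` is unchanged. [folklore] -/
@[simp] theorem shrink_b (δ' : ℝ) (h0 : 0 < δ') (hle : δ' ≤ B.U.δ) : (B.shrink δ' h0 hle).b = B.b := rfl

/-- A Morse frame survives shrinking (same `f`, same field). [folklore] -/
theorem MorseFrame.shrink {B : BiCollar X} (Fr : B.MorseFrame) (δ' : ℝ) (h0 : 0 < δ') (hle : δ' ≤ B.U.δ) :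
    (B.shrink δ' h0 hle).MorseFrame :=
  ⟨Fr.isMorse, Fr.isGradientLike⟩

/-! ### The `TriData` of a pair of levels -/

section OfLevels

variable {B} (Fr : B.MorseFrame) {c η gapW : ℝ} (hac : B.a < c)
  (hreg : ∀ x, B.f x = c → ¬ IsMCriticalPt (𝓡 4) B.f x) (hη : 0 < η) (hgw : 0 < gapW)

/-- The half-width of the shrunk band: `min δ_U ((c - a)/4)`. [folklore] -/
def δ₀ (B : BiCollar X) (c : ℝ) : ℝ := min B.U.δ ((c - B.a) / 4)

include hac in
/-- The half-width is positive. [folklore] -/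
theorem δ₀_pos : 0 < δ₀ B c := lt_min B.U.δ_pos (by linarith)

/-- The half-width is at most the old one. [folklore] -/
theorem δ₀_le : δ₀ B c ≤ B.U.δ := min_le_left _ _

/-- The half-width is at most a quarter of `c - a`. [folklore] -/
theorem δ₀_le_quarter : δ₀ B c ≤ (c - B.a) / 4 := min_le_right _ _

/-- The bi-collar with the shrunk band. [folklore] -/
def shrunk (B : BiCollar X) (c : ℝ) (hac : B.a < c) : BiCollar X := B.shrink (δ₀ B c) (δ₀_pos hac) δ₀_le

/-- The rounding width: `min ((c - a)/4) (min (η/2) (gapW/4))`. [folklore] -/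
def εOf (B : BiCollar X) (c η gapW : ℝ) : ℝ := min ((c - B.a) / 4) (min (η / 2) (gapW / 4))

include hac hη hgw in
/-- The rounding width is positive. [folklore] -/
theorem εOf_pos : 0 < εOf B c η gapW := lt_min (by linarith) (lt_min (by linarith) (by linarith))

/-- Bounds of the rounding width. [folklore] -/
theorem εOf_le : εOf B c η gapW ≤ (c - B.a) / 4 ∧ εOf B c η gapW ≤ η / 2 ∧ εOf B c η gapW ≤ gapW / 4 :=
  ⟨min_le_left _ _, (min_le_right _ _).trans (min_le_left _ _), (min_le_right _ _).trans (min_le_right _ _)⟩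

/-- **The `TriData` of the levels `a < c`** with margin `η` and gap width `gapW`: shrink the
band of `U` to half-width `min δ_U ((c - a)/4)`, take a bevel of small slope
(`exists_bevelData_small`), and rounding width `ε = min ((c - a)/4) (η/2) (gapW/4)`.
[cite: GayKirby2016, §4, Lemma 14] -/
def TriData.ofLevels : (shrunk B c hac).TriData where
  Fr := Fr.shrink _ _ _
  D := Classical.choose (shrunk B c hac).exists_bevelData_small
  c := c
  band_le_c := by
    show B.a + δ₀ B c ≤ c
    linarith [δ₀_le_quarter (B := B) (c := c)]
  regular_c := hreg
  ε := εOf B c η gapW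
  ε_pos := εOf_pos hac hη hgw
  ε_le := by
    have h1 : (Classical.choose (shrunk B c hac).exists_bevelData_small).εw ≤ δ₀ B c :=
      (Classical.choose (shrunk B c hac).exists_bevelData_small).εw_le_δU
    have h2 := δ₀_le_quarter (B := B) (c := c)
    have h3 := (εOf_le (B := B) (c := c) (η := η) (gapW := gapW)).1
    show εOf B c η gapW ≤ c - B.a - 2 * (Classical.choose (shrunk B c hac).exists_bevelData_small).εw
    linarith

/-- The top level of `ofLevels` is `c`. [folklore] -/
@[simp] theorem TriData.ofLevels_c : (TriData.ofLevels Fr hac hreg hη hgw).c = c := rfl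

/-- The rounding width of `ofLevels`. [folklore] -/
theorem TriData.ofLevels_ε : (TriData.ofLevels Fr hac hreg hη hgw).ε = εOf B c η gapW := rfl

/-- **The side condition `hc2`** holds for `ofLevels`. [cite: GayKirby2016, §4, Lemma 14] -/
theorem TriData.hc2_ofLevels :
    (shrunk B c hac).a + (shrunk B c hac).U.δ + 2 * (TriData.ofLevels Fr hac hreg hη hgw).ε ≤
      (TriData.ofLevels Fr hac hreg hη hgw).c := by
  show B.a + δ₀ B c + 2 * εOf B c η gapW ≤ c
  linarith [δ₀_le_quarter (B := B) (c := c), (εOf_le (B := B) (c := c) (η := η) (gapW := gapW)).1]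

/-- **The side condition `hη`** holds for `ofLevels`. [cite: GayKirby2016, §4, Lemma 14] -/
theorem TriData.two_mul_ε_ofLevels_le : 2 * (TriData.ofLevels Fr hac hreg hη hgw).ε ≤ η := by
  show 2 * εOf B c η gapW ≤ η
  linarith [(εOf_le (B := B) (c := c) (η := η) (gapW := gapW)).2.1]

/-- The rounding width of `ofLevels` is at most `gapW/4`. [folklore] -/
theorem TriData.ε_ofLevels_le_gap : (TriData.ofLevels Fr hac hreg hη hgw).ε ≤ gapW / 4 :=
  (εOf_le (B := B) (c := c) (η := η) (gapW := gapW)).2.2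

/-- The bevel of `ofLevels` has small slope. [folklore] -/
theorem TriData.ofLevels_D_small : ∃ L : ℝ, (∀ s, |deriv (TriData.ofLevels Fr hac hreg hη hgw).D.χ₁ s| ≤ L) ∧
    (TriData.ofLevels Fr hac hreg hη hgw).D.κ * L * (TriData.ofLevels Fr hac hreg hη hgw).D.χ₂.rOut ≤ 1 / 4 :=
  Classical.choose_spec (shrunk B c hac).exists_bevelData_small

end OfLevels

section SectorOne

variable [T2Space X] [CompactSpace X] {B} (Fr : B.MorseFrame) {c η gapW : ℝ} (hac : B.a < c)
  (hreg : ∀ x, B.f x = c → ¬ IsMCriticalPt (𝓡 4) B.f x) (hη : 0 < η) (hgw : 0 < gapW)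

/-- **The first sector of `ofLevels` has the handle decomposition `handleCount 1 k`** as soon as
`f` has one critical point of index `0`, `k` of index `1` and none of other indices below `a`
(`TrisectionsSectorOneHandles.lean`): the hypothesis `h₁` of `isGKTrisection_of_handles` is
discharged. [cite: GayKirby2016, §4, Lemma 14] -/
theorem TriData.hasHandleDecomposition_sector_ofLevels {k : ℕ}
    (hcount : ∀ i, (criticalSetOfIndex (𝓡 4) B.f i ∩ B.f ⁻¹' Iio B.a).ncard = handleCount 1 k i) :
    letI := (TriData.ofLevels Fr hac hreg hη hgw).D.cornerSliceAtlas.chartedSpace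
    HasHandleDecomposition 3 (TriData.ofLevels Fr hac hreg hη hgw).D.sector (handleCount 1 k) := by
  obtain ⟨L, hL, hκ⟩ := TriData.ofLevels_D_small Fr hac hreg hη hgw
  have h := (TriData.ofLevels Fr hac hreg hη hgw).D.hasHandleDecomposition_sector_of_small (Fr.shrink _ _ _) hL hκ
  have heq : (fun i => (criticalSetOfIndex (𝓡 4) (shrunk B c hac).f i ∩ (shrunk B c hac).f ⁻¹' Iio (shrunk B c hac).a).ncard) =
      handleCount 1 k := funext hcount
  rw [heq] at h
  exact h

/-- **The third sector of `ofLevels` has the handle decomposition `handleCount 1 k`** as soon as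
`f` has one critical point of index `4`, `k` of index `3` and none of index `≤ 2` above `c`, no
critical value in `(c, c + gapW]`, and the Heegaard function ranges in `[b - gapW/2, b + gapW/2]`
(`TrisectionsSectorThreeHandles.lean`): the hypothesis `h₃` of `isGKTrisection_of_handles` is
discharged. [cite: GayKirby2016, §4, Lemma 14] -/
theorem TriData.hasHandleDecomposition_X₃_ofLevels
    (hL : ∀ q : X, IsMCriticalPt (𝓡 4) B.f q → B.a < B.f q → B.f q ≤ c →
      ∀ y : B.Y, RegularLevel.incl B.hf y ∈ stableSet (𝓡 4) B.U.ξ q → B.g y < B.b - η)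
    (hgap : ∀ q, IsMCriticalPt (𝓡 4) B.f q → B.f q ≤ c ∨ c + gapW < B.f q)
    (hG : ∀ y : B.Y, |B.g y - B.b| ≤ gapW / 2) {k : ℕ}
    (h4 : (criticalSetOfIndex (𝓡 4) B.f 4 ∩ B.f ⁻¹' Ioi c).ncard = 1)
    (h3 : (criticalSetOfIndex (𝓡 4) B.f 3 ∩ B.f ⁻¹' Ioi c).ncard = k)
    (hlt : ∀ i, i ≤ 2 → (criticalSetOfIndex (𝓡 4) B.f i ∩ B.f ⁻¹' Ioi c).ncard = 0) :
    letI := ((TriData.ofLevels Fr hac hreg hη hgw).cornerSliceAtlas₃ (TriData.hc2_ofLevels Fr hac hreg hη hgw)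
      (TriData.two_mul_ε_ofLevels_le Fr hac hreg hη hgw) hL).chartedSpace
    HasHandleDecomposition 3 (TriData.ofLevels Fr hac hreg hη hgw).X₃ (handleCount 1 k) := by
  set T := TriData.ofLevels Fr hac hreg hη hgw with hT
  obtain ⟨L, hLd, hκ⟩ := TriData.ofLevels_D_small Fr hac hreg hη hgw
  have hΓ : ∀ x, |(shrunk B c hac).gFun x| ≤ gapW / 2 := fun x => hG _
  have hδ : 0 < (shrunk B c hac).U.δ := (shrunk B c hac).U.δ_pos
  set σ₀ : ℝ := min ((shrunk B c hac).U.δ / 2) (gapW / 8) with hσ₀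
  have hσ : 0 < σ₀ := lt_min (by linarith) (by linarith)
  have hσδ : 2 * σ₀ ≤ (shrunk B c hac).U.δ := by linarith [min_le_left ((shrunk B c hac).U.δ / 2) (gapW / 8)]
  have hε := TriData.ε_ofLevels_le_gap Fr hac hreg hη hgw
  have hgap' : ∀ q, IsMCriticalPt (𝓡 4) (shrunk B c hac).f q → (shrunk B c hac).f q ≤ T.c ∨
      T.c + gapW / 2 + T.ε + σ₀ < (shrunk B c hac).f q := fun q hq => by
    rcases hgap q hq with h | h
    · exact Or.inl h
    · right
      have hσ8 : σ₀ ≤ gapW / 8 := min_le_right _ _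
      show c + gapW / 2 + T.ε + σ₀ < B.f q
      linarith
  obtain ⟨P⟩ := T.nonempty_sectorThreeParams hLd hκ hΓ hσ hσδ hgap'
  exact P.hasHandleDecomposition_X₃_handleCount (TriData.hc2_ofLevels Fr hac hreg hη hgw)
    (TriData.two_mul_ε_ofLevels_le Fr hac hreg hη hgw) hL h4 h3 hlt

end SectorOne

/-! ### Balanced trisections from the seven handle decompositions -/

section Balanced

variable [T2Space X] [CompactSpace X] [SecondCountableTopology X] {B} (Fr : B.MorseFrame) {c η gapW : ℝ}
  (hac : B.a < c)
  (hreg : ∀ x, B.f x = c → ¬ IsMCriticalPt (𝓡 4) B.f x) (hη : 0 < η) (hgw : 0 < gapW)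
  (hL : ∀ q : X, IsMCriticalPt (𝓡 4) B.f q → B.a < B.f q → B.f q ≤ c →
    ∀ y : B.Y, RegularLevel.incl B.hf y ∈ stableSet (𝓡 4) B.U.ξ q → B.g y < B.b - η)

/-- `![k, k, k]` is the constant family. [folklore] -/
theorem vec3_const (k : ℕ) : (![k, k, k] : Fin 3 → ℕ) = fun _ => k := by
  funext i; fin_cases i <;> rfl

include hL in
/-- **A balanced trisection from the Morse data of `f` outside `[a, c]` and four handle
decompositions.**  For the `TriData` `T = ofLevels` of bi-collar data with Morse `f` and
gradient-like field, a regular top level `c > a`, a margin `η > 0` satisfying the link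
condition, `handleCount 1 k` data of `f` below `a` and (turned about) above `c`, a gap of
width `gapW` above `c` free of critical values with the Heegaard function ranging in
`[b - gapW/2, b + gapW/2]`, a handle decomposition `handleCount 1 k` of the straightened `X₂`
and `handleCount 1 gen` of `{g ≤ b}`, `{b ≤ g}`, `H₂₃`: the sectors of `T` form a balanced
`(gen, k)`-trisection of `X`.
[cite: GayKirby2016, Def. 1; §4, Lemma 14; Thm. 4] -/
theorem isBalancedGKTrisection_ofLevels {gen k : ℕ}
    (h₁ : ∀ i, (criticalSetOfIndex (𝓡 4) B.f i ∩ B.f ⁻¹' Iio B.a).ncard = handleCount 1 k i)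
    (h₂ : letI := ((TriData.ofLevels Fr hac hreg hη hgw).cornerSliceAtlas₂
        (TriData.hc2_ofLevels Fr hac hreg hη hgw) (TriData.two_mul_ε_ofLevels_le Fr hac hreg hη hgw) hL).chartedSpace
      HasHandleDecomposition 3 (TriData.ofLevels Fr hac hreg hη hgw).X₂ (handleCount 1 k))
    (hgap : ∀ q, IsMCriticalPt (𝓡 4) B.f q → B.f q ≤ c ∨ c + gapW < B.f q)
    (hG : ∀ y : B.Y, |B.g y - B.b| ≤ gapW / 2)
    (h₃₄ : (criticalSetOfIndex (𝓡 4) B.f 4 ∩ B.f ⁻¹' Ioi c).ncard = 1)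
    (h₃₃ : (criticalSetOfIndex (𝓡 4) B.f 3 ∩ B.f ⁻¹' Ioi c).ncard = k)
    (h₃ : ∀ i, i ≤ 2 → (criticalSetOfIndex (𝓡 4) B.f i ∩ B.f ⁻¹' Ioi c).ncard = 0)
    (hH₁₂ : HasHandleDecomposition 2 (RegularSublevel B.hg) (handleCount 1 gen))
    (hH₃₁ : HasHandleDecomposition 2 (RegularSuperlevel B.hg) (handleCount 1 gen))
    (hH₂₃ : letI := ((TriData.ofLevels Fr hac hreg hη hgw).bsliceAtlas
        (TriData.hc2_ofLevels Fr hac hreg hη hgw) (TriData.two_mul_ε_ofLevels_le Fr hac hreg hη hgw) hL).chartedSpace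
      HasHandleDecomposition 2 (TriData.ofLevels Fr hac hreg hη hgw).H₂₃ (handleCount 1 gen)) :
    IsBalancedGKTrisection X gen k (TriData.ofLevels Fr hac hreg hη hgw).sectors := by
  have h := (TriData.ofLevels Fr hac hreg hη hgw).isGKTrisection_of_handles (TriData.hc2_ofLevels Fr hac hreg hη hgw)
    (TriData.two_mul_ε_ofLevels_le Fr hac hreg hη hgw) hL (TriData.hasHandleDecomposition_sector_ofLevels Fr hac hreg hη hgw h₁)
    h₂ (TriData.hasHandleDecomposition_X₃_ofLevels Fr hac hreg hη hgw hL hgap hG h₃₄ h₃₃ h₃) hH₁₂ hH₃₁ hH₂₃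
  rw [vec3_const] at h
  exact h

include hL in
/-- **The shape of `exists_isBalancedGKTrisection` for `X`**, from bi-collar data with the link
condition, the Morse data of `f` outside `[a, c]`, the gap above `c`, and the four remaining
handle decompositions (`k ≤ gen`). [cite: GayKirby2016, Thm. 4] -/
theorem exists_isBalancedGKTrisection_of_handles {gen k : ℕ} (hk : k ≤ gen)
    (h₁ : ∀ i, (criticalSetOfIndex (𝓡 4) B.f i ∩ B.f ⁻¹' Iio B.a).ncard = handleCount 1 k i)
    (h₂ : letI := ((TriData.ofLevels Fr hac hreg hη hgw).cornerSliceAtlas₂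
        (TriData.hc2_ofLevels Fr hac hreg hη hgw) (TriData.two_mul_ε_ofLevels_le Fr hac hreg hη hgw) hL).chartedSpace
      HasHandleDecomposition 3 (TriData.ofLevels Fr hac hreg hη hgw).X₂ (handleCount 1 k))
    (hgap : ∀ q, IsMCriticalPt (𝓡 4) B.f q → B.f q ≤ c ∨ c + gapW < B.f q)
    (hG : ∀ y : B.Y, |B.g y - B.b| ≤ gapW / 2)
    (h₃₄ : (criticalSetOfIndex (𝓡 4) B.f 4 ∩ B.f ⁻¹' Ioi c).ncard = 1)
    (h₃₃ : (criticalSetOfIndex (𝓡 4) B.f 3 ∩ B.f ⁻¹' Ioi c).ncard = k)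
    (h₃ : ∀ i, i ≤ 2 → (criticalSetOfIndex (𝓡 4) B.f i ∩ B.f ⁻¹' Ioi c).ncard = 0)
    (hH₁₂ : HasHandleDecomposition 2 (RegularSublevel B.hg) (handleCount 1 gen))
    (hH₃₁ : HasHandleDecomposition 2 (RegularSuperlevel B.hg) (handleCount 1 gen))
    (hH₂₃ : letI := ((TriData.ofLevels Fr hac hreg hη hgw).bsliceAtlas
        (TriData.hc2_ofLevels Fr hac hreg hη hgw) (TriData.two_mul_ε_ofLevels_le Fr hac hreg hη hgw) hL).chartedSpace
      HasHandleDecomposition 2 (TriData.ofLevels Fr hac hreg hη hgw).H₂₃ (handleCount 1 gen)) :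
    ∃ (g k : ℕ) (S : Fin 3 → Set X), k ≤ g ∧ IsBalancedGKTrisection X g k S :=
  ⟨gen, k, _, hk, isBalancedGKTrisection_ofLevels Fr hac hreg hη hgw hL h₁ h₂ hgap hG h₃₄ h₃₃ h₃ hH₁₂ hH₃₁ hH₂₃⟩

end Balanced

end BiCollar

end Literature.Topology.FourManifolds

end
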